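import Literature.ModelTheory.FiniteModelTheory.CFIMatchingBase
import HarnessLib

/-!
# The CFI matching graphs `M(R, c)` over a 3-regular rotation map and Duplicator's strategy
# (Dawar–Wilsenach 2025, §7.2, Lemmas 7.3–7.4)

Everything PROVED; no named facts. Support for Theorem 7.2 of Dawar–Wilsenach (the graphs `X(Γ)`,
`X̃(Γ)`: "balanced bipartite graphs … `X ≡^k Y`").

## The graphs

For a `3`-regular rotation map `R : RotGraph M 3` WITHOUT half-edges (the tree's 3-regular bases
`CFIMatching.base3`, file `CFIMatchingBase.lean`) and CHARGES `c : Fin M → ZMod 2`, the graph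
`mgraph R c` on the uniform vertex type `MVert M` has, for every base vertex `w`,
* four INNER vertices `(w, S')`, `S' : Fin 2 → ZMod 2`, standing for the subset of the three darts
  of `w` with indicator `bit (c w) S'` — the bits of `S'` on darts `0, 1` and the bit
  `c w + S' 0 + S' 1` on dart `2`, so that the represented subsets are exactly those of parity
  `c w` (the printed `v_S`, `|S|` even, resp. odd at the special vertex);
* one BALANCE vertex `w_b`, adjacent to the four inner vertices;
* END vertices `(δ, a)` for darts `δ` at `w` and `a : ZMod 2`, `(δ, a)` adjacent to `(w, S')` iff
  the bit of `δ` in the represented subset is `a` (the printed `e_a — v_S` iff `[e ∈ S] = a`);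
* LINK vertices `L(δ, a)`: for the CANONICAL dart `δ` of an edge (`δ` below `rot δ` in a fixed
  linear order) `L(δ, a)` subdivides the printed shared edge vertex: `L(δ,a) — (δ, a)` and
  `L(δ,a) — (rot δ, a)`; for the non-canonical dart the two vertices `L(δ,0) — L(δ,1)` form an
  isolated edge (so that the vertex type does not depend on `R`).
Thus `mgraph R c` is the printed `X(Γ)` (`c = 0`) resp. `X̃_x(Γ)` (`c = 1_x`) with every shared
edge vertex `e_a` replaced by the path `(δ,a) — L(δ,a) — (rot δ, a)` and `3M` isolated edges
added; perfect matchings correspond bijectively to those of the printed graphs (the link vertex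
takes one end, the other end is matched into its gadget), see `CFIMatchingCount.lean`.

## Shifts and the strategy (Lemmas 7.3, 7.4)

`mshift g` (for `g` constant on edges) is an isomorphism `M(R, c) ≅ M(R, c + ∂g)`
(`mgraph_adj_shift_iff`; Lemma 7.3 is the case `∂g = 1_x + 1_y`), adjacency depends on the
charges only at the base vertices of the two vertices (`mgraph_adj_congr`), and Duplicator wins
the bijective `K`-pebble game on `M(R, c)` and `M(R, 0)` whenever `R` is an `η`-edge-expander
on `M ≥ 2` vertices and `6K < ηM` (`ckEquiv_mgraph`) — the strategy from local consistency of
`TseitinColouring.lean` (Atserias–Dawar 2019, Lemma 3.2; Cai–Fürer–Immerman 1992, §6), replacing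
the printed appeal to treewidth (Lemma 7.4, via Dawar–Richerby [12, Thm. 3]).

## References

* A. Dawar, G. Wilsenach, *Symmetric arithmetic circuits*, Theory of Computing 21 (2025), §7.2
  (gadgets, Fig. 1, Lemmas 7.3–7.4), pp. 19–20.
* A. Atserias, A. Dawar, J. Logic Comput. 29 (2019), Lemma 3.2 (the strategy).
* J.-Y. Cai, M. Fürer, N. Immerman, Combinatorica 12 (1992), §6.
-/

noncomputable section

open scoped Classical

namespace Literature.ModelTheory.FiniteModelTheory.CFIMatching

open Finset
open Literature.Computability.Complexity.Expander (RotGraph)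
open TseitinColouring (EdgeExpansion Dart terr comp bd DAdm LocCons restrictTo extend_many dAdm_restrict
  locCons_restrict constraint_of_blocked locCons_empty dAdm_empty)

variable {M : ℕ}

/-! ### Vertices, represented subsets, the graphs -/

/-- The vertices of `M(R, c)`: inner `(w, S')`, balance `w`, ends `(δ, a)`, links `(δ, a)`.
[cite: DawarWilsenach2025, §7.2 (Gadgets, Fig. 1)] -/
abbrev MVert (M : ℕ) : Type := (Fin M × (Fin 2 → ZMod 2)) ⊕ Fin M ⊕ (Dart M 3 × ZMod 2) ⊕ (Dart M 3 × ZMod 2)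

/-- The indicator of the subset of darts represented by the inner vertex `(w, S')` under charge
`cw` at `w`: `S' 0`, `S' 1`, and `cw + S' 0 + S' 1` on the third dart (total parity `cw`).
[cite: DawarWilsenach2025, §7.2 (v_S for |S| even / odd)] -/
def bit (cw : ZMod 2) (S' : Fin 2 → ZMod 2) (j : Fin 3) : ZMod 2 :=
  if j = 0 then S' 0 else if j = 1 then S' 1 else cw + S' 0 + S' 1

variable (R : RotGraph M 3)

/-- The code of a dart in a fixed linear order. [folklore] -/
def code (δ : Dart M 3) : ℕ := (finProdFinEquiv δ : ℕ)

/-- `code` is injective. [folklore] -/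
theorem code_injective : Function.Injective (code (M := M)) := fun _ _ h =>
  finProdFinEquiv.injective (Fin.ext h)

/-- The CANONICAL dart of its edge: below its reverse. [folklore] -/
def Canon (δ : Dart M 3) : Prop := code δ < code (R.rot δ)

/-- Generating adjacency of `M(R, c)`. [cite: DawarWilsenach2025, §7.2 (Gadgets)] -/
def mrel (c : Fin M → ZMod 2) : MVert M → MVert M → Prop
  | .inr (.inr (.inl (δ, a))), .inl (w, S') => δ.1 = w ∧ bit (c w) S' δ.2 = a
  | .inr (.inl w), .inl (w', _) => w = w'
  | .inr (.inr (.inr (δ, a))), .inr (.inr (.inl (δ', a'))) => Canon R δ ∧ a' = a ∧ (δ' = δ ∨ δ' = R.rot δ)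
  | .inr (.inr (.inr (δ, a))), .inr (.inr (.inr (δ', a'))) => ¬ Canon R δ ∧ δ' = δ ∧ a' = a + 1
  | _, _ => False

/-- **The CFI matching graph `M(R, c)`.** [cite: DawarWilsenach2025, §7.2 (X(Γ), X̃(Γ))] -/
def mgraph (c : Fin M → ZMod 2) : SimpleGraph (MVert M) := SimpleGraph.fromRel (mrel R c)

/-! ### Shifts -/

/-- The shift of the vertices by a dart function `g`. [cite: DawarWilsenach2025, Lemma 7.3 (proof: "interchanging e_0 and e_1 … induced automorphisms of the gadgets")] -/
def mshift (g : Dart M 3 → ZMod 2) : MVert M → MVert M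
  | .inl (w, S') => .inl (w, S' + fun i => g (w, Fin.castSucc i))
  | .inr (.inl w) => .inr (.inl w)
  | .inr (.inr (.inl (δ, a))) => .inr (.inr (.inl (δ, a + g δ)))
  | .inr (.inr (.inr (δ, a))) => .inr (.inr (.inr (δ, a + g δ)))

/-- `a + a = 0` in `ZMod 2`. [folklore] -/
theorem zmod2_add_self (a : ZMod 2) : a + a = 0 := CharTwo.add_self_eq_zero a

/-- The two elements of `ZMod 2`. [folklore] -/
theorem zmod2_eq_zero_or_one (a : ZMod 2) : a = 0 ∨ a = 1 := by revert a; decide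

/-- Shifting twice is the identity. [folklore] -/
theorem mshift_mshift (g : Dart M 3 → ZMod 2) (x : MVert M) : mshift g (mshift g x) = x := by
  rcases x with ⟨w, S'⟩ | w | ⟨δ, a⟩ | ⟨δ, a⟩
  · simp only [mshift, Sum.inl.injEq, Prod.mk.injEq, true_and]
    funext i; simp [add_assoc, zmod2_add_self]
  · rfl
  · simp [mshift, add_assoc, zmod2_add_self]
  · simp [mshift, add_assoc, zmod2_add_self]

/-- The shift is an involution. [folklore] -/
theorem mshift_involutive (g : Dart M 3 → ZMod 2) : Function.Involutive (mshift (M := M) g) := mshift_mshift g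

/-- **The represented bits transform additively under a shift**: the bit of dart `j` of `w` for
the shifted inner vertex and the shifted charge is the old bit plus `g (w, j)`. [folklore] -/
theorem bit_shift (c : Fin M → ZMod 2) (g : Dart M 3 → ZMod 2) (w : Fin M) (S' : Fin 2 → ZMod 2) (j : Fin 3) :
    bit ((c + bd g) w) (S' + fun i => g (w, Fin.castSucc i)) j = bit (c w) S' j + g (w, j) := by
  unfold bit
  by_cases h0 : j = 0
  · subst h0; simp
  · by_cases h1 : j = 1
    · subst h1; simp
    · obtain rfl : j = 2 := fin3_eq_two h0 h1
      simp only [Fin.reduceEq, ↓reduceIte, Pi.add_apply, bd, Fin.sum_univ_three]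
      have e0 : (Fin.castSucc (0 : Fin 2) : Fin 3) = 0 := rfl
      have e1 : (Fin.castSucc (1 : Fin 2) : Fin 3) = 1 := rfl
      rw [e0, e1]
      have := zmod2_add_self (g (w, 0))
      have := zmod2_add_self (g (w, 1))
      -- rearrange in characteristic two
      have key : ∀ x y z u v : ZMod 2, x + (y + z + u) + (v + y) + (S' 1 + z) = x + v + S' 1 + u + (y + y) + (z + z) := by
        intro x y z u v; ring
      rw [key, zmod2_add_self, zmod2_add_self, add_zero, add_zero]

/-- **The shift by a `g` constant on edges transports `mrel c` to `mrel (c + ∂g)`.**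
[cite: DawarWilsenach2025, Lemma 7.3 (proof)] -/
theorem mrel_shift_iff {g : Dart M 3 → ZMod 2} (hg : ∀ δ, g (R.rot δ) = g δ) (c : Fin M → ZMod 2) (x y : MVert M) :
    mrel R (c + bd g) (mshift g x) (mshift g y) ↔ mrel R c x y := by
  rcases x with ⟨w, S⟩ | w | ⟨δ, a⟩ | ⟨δ, a⟩ <;> rcases y with ⟨w', S'⟩ | w' | ⟨δ', a'⟩ | ⟨δ', a'⟩ <;>
    simp only [mshift, mrel]
  · -- end / inner
    constructor
    · rintro ⟨rfl, h⟩
      refine ⟨rfl, ?_⟩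
      rw [bit_shift] at h
      exact add_right_cancel h
    · rintro ⟨rfl, h⟩
      refine ⟨rfl, ?_⟩
      rw [bit_shift, h]
  · -- link / end
    have hvv : (δ' = δ ∨ δ' = R.rot δ) → g δ' = g δ := by
      rintro (rfl | rfl)
      · rfl
      · exact hg δ
    constructor
    · rintro ⟨hc, ha, hδ⟩
      refine ⟨hc, ?_, hδ⟩
      rw [hvv hδ] at ha
      exact add_right_cancel ha
    · rintro ⟨hc, rfl, hδ⟩
      exact ⟨hc, by rw [hvv hδ], hδ⟩
  · -- link / link
    constructor
    · rintro ⟨hc, rfl, ha⟩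
      refine ⟨hc, rfl, ?_⟩
      rw [add_right_comm] at ha
      exact add_right_cancel ha
    · rintro ⟨hc, rfl, rfl⟩
      exact ⟨hc, rfl, add_right_comm _ _ _⟩

/-- **Hence the shift is an isomorphism `M(R, c) ≅ M(R, c + ∂g)`** (Lemma 7.3: for a path `x … y`
the gauge along the path is an isomorphism `X̃_x(Γ) ≅ X̃_y(Γ)`). [cite: DawarWilsenach2025, Lemma 7.3] -/
theorem mgraph_adj_shift_iff {g : Dart M 3 → ZMod 2} (hg : ∀ δ, g (R.rot δ) = g δ) (c : Fin M → ZMod 2) (x y : MVert M) :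
    (mgraph R (c + bd g)).Adj (mshift g x) (mshift g y) ↔ (mgraph R c).Adj x y := by
  simp only [mgraph, SimpleGraph.fromRel_adj, ne_eq, (mshift_involutive g).injective.eq_iff, mrel_shift_iff R hg]

/-! ### Charges only matter at the base vertex -/

/-- The base vertex sees the same charge in `c` and `c'` (only inner vertices see charges). [folklore] -/
def MAgrees (c c' : Fin M → ZMod 2) : MVert M → Prop
  | .inl (w, _) => c w = c' w
  | _ => True

/-- Charge functions agreeing at the bases of `x` and `y` generate the same adjacency. [folklore] -/
theorem mrel_congr {c c' : Fin M → ZMod 2} {x y : MVert M} (hx : MAgrees c c' x) (hy : MAgrees c c' y) :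
    mrel R c x y ↔ mrel R c' x y := by
  rcases x with ⟨w, S⟩ | w | ⟨δ, a⟩ | ⟨δ, a⟩ <;> rcases y with ⟨w', S'⟩ | w' | ⟨δ', a'⟩ | ⟨δ', a'⟩ <;>
    simp only [mrel, MAgrees] at hx hy ⊢
  constructor
  · rintro ⟨rfl, h⟩; exact ⟨rfl, by rw [← hy]; exact h⟩
  · rintro ⟨rfl, h⟩; exact ⟨rfl, by rw [hy]; exact h⟩

/-- Charge functions agreeing at the bases of `x` and `y` give the same adjacency. [folklore] -/
theorem mgraph_adj_congr {c c' : Fin M → ZMod 2} {x y : MVert M} (hx : MAgrees c c' x) (hy : MAgrees c c' y) :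
    (mgraph R c).Adj x y ↔ (mgraph R c').Adj x y := by
  simp only [mgraph, SimpleGraph.fromRel_adj, mrel_congr R hx hy, mrel_congr R hy hx]

/-! ### Needed darts -/

/-- The darts whose values determine the shift of `x` (for inner vertices: all darts of the base
vertex and their reverses, so that a pebbled inner vertex isolates its base vertex). [folklore] -/
def mneed : MVert M → Finset (Dart M 3)
  | .inl (w, _) => (univ.image fun i : Fin 3 => ((w, i) : Dart M 3)) ∪ (univ.image fun i : Fin 3 => R.rot (w, i))
  | .inr (.inl _) => ∅
  | .inr (.inr (.inl (δ, _))) => {δ, R.rot δ}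
  | .inr (.inr (.inr (δ, _))) => {δ, R.rot δ}

/-- The needed darts are closed under reversal. [folklore] -/
theorem rot_mem_mneed {x : MVert M} {δ : Dart M 3} (h : δ ∈ mneed R x) : R.rot δ ∈ mneed R x := by
  rcases x with ⟨w, S⟩ | w | ⟨δ', a⟩ | ⟨δ', a⟩
  · simp only [mneed, Finset.mem_union, Finset.mem_image, Finset.mem_univ, true_and] at h ⊢
    rcases h with ⟨i, rfl⟩ | ⟨i, rfl⟩
    · exact Or.inr ⟨i, rfl⟩
    · exact Or.inl ⟨i, (R.rot_rot _).symm⟩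
  · simp [mneed] at h
  · simp only [mneed, Finset.mem_insert, Finset.mem_singleton] at h ⊢
    rcases h with rfl | rfl
    · exact Or.inr rfl
    · exact Or.inl (R.rot_rot _)
  · simp only [mneed, Finset.mem_insert, Finset.mem_singleton] at h ⊢
    rcases h with rfl | rfl
    · exact Or.inr rfl
    · exact Or.inl (R.rot_rot _)

/-- A vertex needs at most `6` darts. [folklore] -/
theorem card_mneed_le (x : MVert M) : (mneed R x).card ≤ 2 * 3 := by
  rcases x with ⟨w, S⟩ | w | ⟨δ, a⟩ | ⟨δ, a⟩
  · simp only [mneed]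
    refine (Finset.card_union_le _ _).trans ?_
    have h1 := Finset.card_image_le (s := (univ : Finset (Fin 3))) (f := fun i : Fin 3 => ((w, i) : Dart M 3))
    have h2 := Finset.card_image_le (s := (univ : Finset (Fin 3))) (f := fun i : Fin 3 => R.rot (w, i))
    simp only [Finset.card_univ, Fintype.card_fin] at h1 h2
    omega
  · simp [mneed]
  · simp only [mneed]; exact (Finset.card_insert_le _ _).trans (by simp)
  · simp only [mneed]; exact (Finset.card_insert_le _ _).trans (by simp)

/-- An inner vertex at `w` needs every dart at `w`. [folklore] -/
theorem mem_mneed_inner (w : Fin M) (S : Fin 2 → ZMod 2) (i : Fin 3) : ((w, i) : Dart M 3) ∈ mneed R (.inl (w, S)) := by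
  simp [mneed]

/-- An end vertex needs its dart. [folklore] -/
theorem mem_mneed_end (δ : Dart M 3) (a : ZMod 2) : δ ∈ mneed R (.inr (.inr (.inl (δ, a)))) := by simp [mneed]

/-- A link vertex needs its dart. [folklore] -/
theorem mem_mneed_link (δ : Dart M 3) (a : ZMod 2) : δ ∈ mneed R (.inr (.inr (.inr (δ, a)))) := by simp [mneed]

/-- Two dart functions agreeing on `mneed x` shift `x` identically. [folklore] -/
theorem mshift_congr {g g' : Dart M 3 → ZMod 2} {x : MVert M} (h : ∀ δ ∈ mneed R x, g δ = g' δ) :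
    mshift g x = mshift g' x := by
  rcases x with ⟨w, S⟩ | w | ⟨δ, a⟩ | ⟨δ, a⟩
  · simp only [mshift, Sum.inl.injEq, Prod.mk.injEq, true_and]
    funext i
    simp only [Pi.add_apply, h (w, Fin.castSucc i) (mem_mneed_inner R w S _)]
  · rfl
  · simp only [mshift, h δ (mem_mneed_end R δ a)]
  · simp only [mshift, h δ (mem_mneed_link R δ a)]

/-- The darts needed by a position. [folklore] -/
def MNeed (p : Set (MVert M × MVert M)) : Finset (Dart M 3) := univ.filter fun δ => ∃ x ∈ p, δ ∈ mneed R x.1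

/-- Membership in `MNeed`. [folklore] -/
theorem mem_MNeed {p : Set (MVert M × MVert M)} {δ : Dart M 3} : δ ∈ MNeed R p ↔ ∃ x ∈ p, δ ∈ mneed R x.1 := by
  simp [MNeed]

/-- `MNeed` is monotone. [folklore] -/
theorem MNeed_mono {p q : Set (MVert M × MVert M)} (h : q ⊆ p) : MNeed R q ⊆ MNeed R p := by
  intro δ hδ
  rw [mem_MNeed] at hδ ⊢
  obtain ⟨x, hx, hδ⟩ := hδ
  exact ⟨x, h hx, hδ⟩

/-- `MNeed` is closed under reversal. [folklore] -/
theorem rot_mem_MNeed {p : Set (MVert M × MVert M)} {δ : Dart M 3} (h : δ ∈ MNeed R p) : R.rot δ ∈ MNeed R p := by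
  rw [mem_MNeed] at h ⊢
  obtain ⟨x, hx, hδ⟩ := h
  exact ⟨x, hx, rot_mem_mneed R hδ⟩

/-- A pebbled vertex has its needed darts in `MNeed`. [folklore] -/
theorem mneed_subset_MNeed {p : Set (MVert M × MVert M)} {x : MVert M × MVert M} (hx : x ∈ p) :
    mneed R x.1 ⊆ MNeed R p := fun _ hδ => (mem_MNeed R).2 ⟨x, hx, hδ⟩

/-- The empty position needs nothing. [folklore] -/
theorem MNeed_empty : MNeed R (∅ : Set (MVert M × MVert M)) = ∅ := by
  ext δ; simp [mem_MNeed]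

/-- `MNeed` of an enlarged position. [folklore] -/
theorem MNeed_insert (p : Set (MVert M × MVert M)) (z : MVert M × MVert M) :
    MNeed R (insert z p) = mneed R z.1 ∪ MNeed R p := by
  ext δ
  simp only [mem_MNeed, Set.mem_insert_iff, Finset.mem_union]
  constructor
  · rintro ⟨x, rfl | hx, hδ⟩
    · exact Or.inl hδ
    · exact Or.inr ⟨x, hx, hδ⟩
  · rintro (hδ | ⟨x, hx, hδ⟩)
    · exact ⟨z, Or.inl rfl, hδ⟩
    · exact ⟨x, Or.inr hx, hδ⟩

/-- A position with `|p|` pairs needs at most `6 |p|` darts. [folklore] -/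
theorem card_MNeed_le {p : Set (MVert M × MVert M)} (hp : p.Finite) : (MNeed R p).card ≤ 2 * 3 * p.ncard := by
  have heq : MNeed R p = hp.toFinset.biUnion fun x => mneed R x.1 := by
    ext δ; simp [mem_MNeed]
  rw [heq, Set.ncard_eq_toFinset_card p hp]
  refine (Finset.card_biUnion_le).trans ?_
  calc ∑ x ∈ hp.toFinset, (mneed R x.1).card ≤ ∑ _x ∈ hp.toFinset, 2 * 3 :=
        Finset.sum_le_sum fun x _ => card_mneed_le R x.1
    _ = 2 * 3 * hp.toFinset.card := by rw [Finset.sum_const, smul_eq_mul]; ring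

/-! ### The strategy -/

section Strategy

variable {R}
variable {η : ℝ} (hR : EdgeExpansion R η) (c : Fin M → ZMod 2) (hM : 2 ≤ M) {K : ℕ}
  (hK : (2 * 3 * K : ℝ) < η * M)

/-- Winning positions: pebble pairs on the graph of the shift by an admissible, locally
consistent partial assignment of the needed darts. [cite: AtseriasDawar2019, Lemma 3.2 (proof)] -/
structure MGood (p : Set (MVert M × MVert M)) (g : Dart M 3 → ZMod 2) : Prop where
  adm : DAdm R (MNeed R p) g
  cons : LocCons R c (MNeed R p) g
  graph : ∀ x ∈ p, x.2 = mshift g x.1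

include hM in
/-- In a winning position the shifted charge vanishes at the base of every pebbled inner vertex.
[cite: AtseriasDawar2019, Lemma 3.2 (proof)] -/
theorem magrees_of_good {p : Set (MVert M × MVert M)} {g : Dart M 3 → ZMod 2} (hg : MGood (R := R) c p g)
    {x : MVert M × MVert M} (hx : x ∈ p) : MAgrees (c + bd g) 0 (mshift g x.1) := by
  obtain ⟨x1, x2⟩ := x
  rcases x1 with ⟨w, S⟩ | w | ⟨δ, a⟩ | ⟨δ, a⟩
  · show (c + bd g) w = (0 : Fin M → ZMod 2) w
    rw [Pi.add_apply, Pi.zero_apply]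
    exact constraint_of_blocked R hg.cons hM fun i => mneed_subset_MNeed R hx (mem_mneed_inner R w S i)
  · trivial
  · trivial
  · trivial

include hM in
/-- **Winning positions are partial isomorphisms** `M(R, c) ⇀ M(R, 0)`. [cite: AtseriasDawar2019, Lemma 3.2 (proof)] -/
theorem isPartialIso_of_mgood {p : Set (MVert M × MVert M)} {g : Dart M 3 → ZMod 2}
    (hg : MGood (R := R) c p g) : IsPartialIso (mgraph R c) (mgraph R 0) p := by
  refine ⟨fun x hx y hy => ?_, fun x hx y hy => ?_⟩
  · rw [hg.graph x hx, hg.graph y hy]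
    exact ((mshift_involutive g).injective.eq_iff).symm
  · rw [hg.graph x hx, hg.graph y hy]
    rw [← mgraph_adj_congr R (magrees_of_good c hM hg hx) (magrees_of_good c hM hg hy)]
    exact (mgraph_adj_shift_iff R hg.adm.rot_eq c x.1 y.1).symm

/-- Lifting pebbles keeps a position winning. [folklore] -/
theorem mgood_mono {p q : Set (MVert M × MVert M)} {g : Dart M 3 → ZMod 2} (hg : MGood (R := R) c p g)
    (hqp : q ⊆ p) : MGood (R := R) c q (restrictTo (MNeed R q) g) := by
  refine ⟨dAdm_restrict R hg.adm (fun δ hδ => rot_mem_MNeed R hδ),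
    locCons_restrict R hg.adm hg.cons (MNeed_mono R hqp) (fun δ hδ => rot_mem_MNeed R hδ), fun x hx => ?_⟩
  rw [hg.graph x (hqp hx)]
  refine mshift_congr R fun δ hδ => ?_
  have : δ ∈ MNeed R q := mneed_subset_MNeed R hx hδ
  simp [restrictTo, this]

include hR hK in
/-- Budget: a position with fewer than `K` pairs plus one more vertex needs fewer than `η M` darts. [folklore] -/
theorem card_lt_of_ncard_lt' {p : Set (MVert M × MVert M)} (hp : p.Finite) (hpK : p.ncard < K)
    (z : MVert M) : ((MNeed R p ∪ mneed R z).card : ℝ) < η * M := by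
  have h1 : (MNeed R p ∪ mneed R z).card ≤ 2 * 3 * K := by
    refine (Finset.card_union_le _ _).trans ?_
    have := card_MNeed_le R hp
    have := card_mneed_le R z
    calc (MNeed R p).card + (mneed R z).card ≤ 2 * 3 * p.ncard + 2 * 3 := by omega
      _ = 2 * 3 * (p.ncard + 1) := by ring
      _ ≤ 2 * 3 * K := Nat.mul_le_mul_left _ hpK
  have _ := hR
  calc ((MNeed R p ∪ mneed R z).card : ℝ) ≤ ((2 * 3 * K : ℕ) : ℝ) := by exact_mod_cast h1
    _ = 2 * 3 * K := by push_cast; ring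
    _ < η * M := hK

include hR hM hK in
/-- **Duplicator wins the bijective `K`-pebble game on `M(R, c)` and `M(R, 0)`** whenever
`6K < ηM` (`R` an `η`-edge-expander of degree `3` on `M ≥ 2` vertices) — for every charge `c`,
in particular for `X̃(Γ) = M(R, 1_x)` versus `X(Γ) = M(R, 0)` (Lemma 7.4, with expansion in place
of treewidth). [cite: DawarWilsenach2025, Lemma 7.4; AtseriasDawar2019, Lemma 3.2] -/
theorem ckEquiv_mgraph : CkEquiv K (mgraph R c) (mgraph R 0) := by
  refine ⟨{ carrier := {p | p.Finite ∧ p.ncard ≤ K ∧ ∃ g, MGood (R := R) c p g}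
            empty_mem := ?_
            finite_of_mem := fun p hp => hp.1
            ncard_le_of_mem := fun p hp => hp.2.1
            isPartialIso_of_mem := fun p hp => ?_
            mem_of_subset := fun p hp q hqp => ?_
            forth := fun p hp hpK => ?_ }⟩
  · refine ⟨Set.finite_empty, by simp, fun _ => 0, ?_, ?_, fun x hx => (Set.notMem_empty x hx).elim⟩
    · rw [MNeed_empty]; exact dAdm_empty R
    · rw [MNeed_empty]; exact locCons_empty R hR c
  · obtain ⟨g, hg⟩ := hp.2.2
    exact isPartialIso_of_mgood c hM hg
  · obtain ⟨g, hg⟩ := hp.2.2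
    exact ⟨hp.1.subset hqp, (Set.ncard_le_ncard hqp hp.1).trans hp.2.1, _, mgood_mono c hg hqp⟩
  · obtain ⟨hpfin, -, g, hg⟩ := hp
    have hex : ∀ z : MVert M, ∃ g', DAdm R (MNeed R p ∪ mneed R z) g' ∧
        LocCons R c (MNeed R p ∪ mneed R z) g' ∧ ∀ δ ∈ MNeed R p, g' δ = g δ := fun z =>
      extend_many R hR (mneed R z) (fun δ hδ => rot_mem_mneed R hδ) _ (MNeed R p) g le_rfl hg.adm hg.cons
        (card_lt_of_ncard_lt' hR hK hpfin hpK z)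
    have hexS : ∀ S : Finset (Dart M 3), (∃ z : MVert M, mneed R z = S) →
        ∃ g', DAdm R (MNeed R p ∪ S) g' ∧ LocCons R c (MNeed R p ∪ S) g' ∧ ∀ δ ∈ MNeed R p, g' δ = g δ := by
      rintro S ⟨z, rfl⟩; exact hex z
    set E : Finset (Dart M 3) → Dart M 3 → ZMod 2 := fun S =>
      if h : ∃ z : MVert M, mneed R z = S then Classical.choose (hexS S h) else g with hE
    have hEspec : ∀ z : MVert M, DAdm R (MNeed R p ∪ mneed R z) (E (mneed R z)) ∧
        LocCons R c (MNeed R p ∪ mneed R z) (E (mneed R z)) ∧ ∀ δ ∈ MNeed R p, E (mneed R z) δ = g δ := by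
      intro z
      have h : ∃ z' : MVert M, mneed R z' = mneed R z := ⟨z, rfl⟩
      have hEz : E (mneed R z) = Classical.choose (hexS _ h) := by simp only [hE, dif_pos h]
      rw [hEz]
      exact Classical.choose_spec (hexS _ h)
    set F : MVert M → MVert M := fun z => mshift (E (mneed R z)) z with hF
    have hFinv : Function.Involutive F := by
      intro z
      have hn : mneed R (mshift (E (mneed R z)) z) = mneed R z := by
        rcases z with ⟨w, S⟩ | w | ⟨δ, a⟩ | ⟨δ, a⟩ <;> rfl
      show mshift (E (mneed R (mshift (E (mneed R z)) z))) (mshift (E (mneed R z)) z) = z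
      rw [hn, mshift_mshift]
    refine ⟨hFinv.toPerm F, fun a => ?_⟩
    have hFa : (hFinv.toPerm F) a = F a := rfl
    rw [hFa]
    obtain ⟨hadm, hcons, heq⟩ := hEspec a
    refine ⟨hpfin.insert _, (Set.ncard_insert_le _ _).trans (Nat.succ_le_of_lt hpK), E (mneed R a), ?_, ?_, ?_⟩
    · rw [MNeed_insert, Finset.union_comm]; exact hadm
    · rw [MNeed_insert, Finset.union_comm]; exact hcons
    · rintro x (rfl | hx)
      · rfl
      · rw [hg.graph x hx]
        exact mshift_congr R fun δ hδ => (heq δ (mneed_subset_MNeed R hx hδ)).symm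

end Strategy

/-! ### Size and bipartiteness -/

/-- `M(R, c)` has `17 M` vertices. [folklore] -/
theorem card_MVert (M : ℕ) : Fintype.card (MVert M) = 17 * M := by
  simp only [MVert, Fintype.card_sum, Fintype.card_prod, Fintype.card_fin, Fintype.card_fun, ZMod.card,
    Fintype.card_prod]
  ring

/-- One side of the bipartition: inner vertices, canonical links, and the `0`-halves of the
isolated link edges. [cite: DawarWilsenach2025, §7.2 ("bipartite graph where one part contains the 4|V| inner vertices")] -/
def sideA : Set (MVert M) := fun x =>
  match x with
  | .inl _ => True
  | .inr (.inl _) => False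
  | .inr (.inr (.inl _)) => False
  | .inr (.inr (.inr (δ, a))) => Canon R δ ∨ a = 0

/-- **`M(R, c)` is bipartite.** [cite: DawarWilsenach2025, Thm 7.2 ("bipartite graphs X and Y")] -/
theorem mgraph_isBipartiteWith (c : Fin M → ZMod 2) : (mgraph R c).IsBipartiteWith (sideA R) (sideA R)ᶜ := by
  refine ⟨disjoint_compl_right, fun x y hxy => ?_⟩
  rw [mgraph, SimpleGraph.fromRel_adj] at hxy
  obtain ⟨-, h⟩ := hxy
  -- analyse the generating relation in either direction
  have key : ∀ x y : MVert M, mrel R c x y → (x ∈ sideA R ∧ y ∈ (sideA R)ᶜ ∨ x ∈ (sideA R)ᶜ ∧ y ∈ sideA R) := by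
    rintro (⟨w, S⟩ | w | ⟨δ, a⟩ | ⟨δ, a⟩) (⟨w', S'⟩ | w' | ⟨δ', a'⟩ | ⟨δ', a'⟩) hr <;>
      simp only [mrel] at hr
    · exact Or.inr ⟨fun h => h, trivial⟩
    · exact Or.inr ⟨fun h => h, trivial⟩
    · exact Or.inl ⟨Or.inl hr.1, fun h => h⟩
    · obtain ⟨hc, rfl, rfl⟩ := hr
      rcases zmod2_eq_zero_or_one a with rfl | rfl
      · refine Or.inl ⟨Or.inr rfl, ?_⟩
        change ¬ (Canon R _ ∨ (0 : ZMod 2) + 1 = 0)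
        rintro (h | h)
        · exact hc h
        · exact absurd h (by decide)
      · refine Or.inr ⟨?_, Or.inr (by decide)⟩
        change ¬ (Canon R _ ∨ (1 : ZMod 2) = 0)
        rintro (h | h)
        · exact hc h
        · exact absurd h (by decide)
  rcases h with h | h
  · exact key x y h
  · rcases key y x h with h' | h'
    · exact Or.inr ⟨h'.2, h'.1⟩
    · exact Or.inl ⟨h'.2, h'.1⟩

end Literature.ModelTheory.FiniteModelTheory.CFIMatching
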